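import Summits.BirchSwinnertonDyer.BirchSwinnertonDyer.Theorems.ManinLocalTwoThreeEulerRemaindersSeventyTwo
import Summits.BirchSwinnertonDyer.BirchSwinnertonDyer.Theorems.ManinLocalTwoThreeEulerRemaindersForty
import HarnessLib

/-!
# Level 108 = 2²·3³, the `q`-toolkit I: `E₃, E₆, E₉, E₁₂, E₁₈, E₂₇, E₃₆` and `E₂(δτ)` (`δ ∈ {3, 6, 9, 12, 18, 36}`) to `o(q³⁷)`

Cell bsd-f2-manin, route `ManinLocalTwoThree` (cruxes C2 `ManinOddAtFour` stmt-22967: `2² ∣ 108`, AND C3 `ManinPrimeToThreeAtNine`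
stmt-22968: `3² ∣ 108` — indeed `27 ∣ 108`, the charter's `27 ∣ N` cell; genus `10`), prover seat p3 gen 24.  The E₂ road
(`EtaLogDerivativeForms`) at level `108`: the optimal curve `108a1 = [0, 0, 0, 0, 4] : y² = x³ + 4` has Weierstrass coordinates
`x = 𝓧 = η₆²η₁₈²/(η₁₂²η₃₆²)` and `y = −(𝓨 + 2)`, `𝓨 = η₃²η₉²/(η₁₂²η₃₆²)` (both `η`-quotients, seat recon `work/g4/recon2.py`), and newform
`φ₁₀₈ = −2B₁ + 2B₂ + B₃ + 6B₄ + 6B₅` on the an-g51 `η`-basis (cell HOME/an/g51, `newform-coords-C.out`).  The identities (I2a)/(I2b)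
become LINEAR relations in `M₂(Γ₀(108))` (sequels), settled by Sturm's bound `⌊2·216/12⌋ = 36 < 37`; this file supplies the
`q`-expansions to `o(q³⁷)`:

* §1 Euler's pentagonal coefficients to `n = 12` (`coeff_formalEulerPow_one_le_twelve`) and `E_δ` for `δ ∈ {3, 6, 9, 12, 18, 27, 36}`
  (`E₅₄, E₁₀₈ = 1 + o(q³⁷)` are `EulerRemainders.tendsto_eulerFn`);
* §2 `σ₁(1..12)` and `E₂(δτ)` for `δ ∈ {3, 6, 9, 12, 18, 36}`.

Pure `q`-series bookkeeping; nothing here proves C2, C3, Manin's conjecture or BSD. [cite: Zagier2008, §2.3] [cite: Ligozat1975, Ch. 3]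
-/

set_option autoImplicit false
-- lint-debt: the directory name repeats the summit name (sibling precedent `ManinLocalTwoThreeEulerRemaindersSeventyTwo.lean`)
set_option linter.dupNamespace false

noncomputable section

open Complex Filter Topology Set Asymptotics Polynomial EisensteinSeries
open UpperHalfPlane hiding I
open scoped Real Topology Manifold MatrixGroups
open Literature.NumberTheory.ModularForms
open Literature.NumberTheory.EllipticCurves Literature.NumberTheory.EllipticCurves.ModularForms

namespace Summit.BirchSwinnertonDyer.BirchSwinnertonDyer.Theorems.ManinLocalTwoThree.EulerRemaindersOneHundredEight

open QRemainder EulerRemainders EtaLogDerivativeForms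

/-! ## §1 Euler's coefficients to `n = 12` and `E₃, E₆, E₉, E₁₂, E₁₈, E₂₇, E₃₆` to `o(q³⁷)` -/

/-- `∏_{n=1}^{12} (1 − Xⁿ)` expanded. [folklore] -/
theorem eulerTrunc_one_twelve : eulerTrunc 1 12 = 1 - PowerSeries.X - PowerSeries.X ^ 2 + PowerSeries.X ^ 5 + PowerSeries.X ^ 7 - PowerSeries.X ^ 12
      + PowerSeries.X ^ 13 - 2 * PowerSeries.X ^ 15 - PowerSeries.X ^ 16 - PowerSeries.X ^ 17
      + PowerSeries.X ^ 20 + PowerSeries.X ^ 21 + 2 * PowerSeries.X ^ 22 + PowerSeries.X ^ 23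
      + PowerSeries.X ^ 24 + 2 * PowerSeries.X ^ 26 - PowerSeries.X ^ 28 - 2 * PowerSeries.X ^ 29
      - 2 * PowerSeries.X ^ 30 - 2 * PowerSeries.X ^ 31 - 2 * PowerSeries.X ^ 32 - PowerSeries.X ^ 33
      - PowerSeries.X ^ 34 + PowerSeries.X ^ 36 + 2 * PowerSeries.X ^ 37 + PowerSeries.X ^ 38
      + 4 * PowerSeries.X ^ 39 + PowerSeries.X ^ 40 + 2 * PowerSeries.X ^ 41 + PowerSeries.X ^ 42
      - PowerSeries.X ^ 44 - PowerSeries.X ^ 45 - 2 * PowerSeries.X ^ 46 - 2 * PowerSeries.X ^ 47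
      - 2 * PowerSeries.X ^ 48 - 2 * PowerSeries.X ^ 49 - PowerSeries.X ^ 50 + 2 * PowerSeries.X ^ 52
      + PowerSeries.X ^ 54 + PowerSeries.X ^ 55 + 2 * PowerSeries.X ^ 56 + PowerSeries.X ^ 57
      + PowerSeries.X ^ 58 - PowerSeries.X ^ 61 - PowerSeries.X ^ 62 - 2 * PowerSeries.X ^ 63
      + PowerSeries.X ^ 65 - PowerSeries.X ^ 66 + PowerSeries.X ^ 71 + PowerSeries.X ^ 73 - PowerSeries.X ^ 76
      - PowerSeries.X ^ 77 + PowerSeries.X ^ 78 := by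
  rw [eulerTrunc]
  simp only [Finset.prod_range_succ, Finset.prod_range_zero]
  ring

/-- `∏_{n ≥ 1} (1 − Xⁿ) = 1 − X − X² + X⁵ + X⁷ − X¹² ± ⋯` (Euler's pentagonal numbers): the coefficients `0, …, 12`. [folklore] -/
theorem coeff_formalEulerPow_one_le_twelve (n : ℕ) (hn : n ≤ 12) :
    PowerSeries.coeff n (formalEulerPow 1)
      = if n = 0 then 1 else if n = 1 then -1 else if n = 2 then -1 else if n = 5 then 1 else if n = 7 then 1
        else if n = 12 then -1 else 0 := by
  rcases Nat.lt_or_ge n 10 with h9 | h10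
  · rw [EulerRemaindersForty.coeff_formalEulerPow_one_le_nine n (by omega)]
    interval_cases n <;> simp
  · rw [coeff_formalEulerPow hn, eulerTrunc_one_twelve]
    interval_cases n <;> simp [PowerSeries.coeff_X_pow, PowerSeries.coeff_X, PowerSeries.coeff_mul_X_pow']

/-- The `q`-coefficients `n ≤ 37` of `E3` (nonzero only at the multiples `3k` with `k ∈ {0, 1, 2, 5, 7, 12}`). [folklore] -/
theorem coeff_formalEulerScaled_three_le (n : ℕ) (hn : n ≤ 37) :
    PowerSeries.coeff n (formalEulerScaled 3) = if n = 0 then 1 else if n = 3 then -1 else if n = 6 then -1 else if n = 15 then 1 else if n = 21 then 1 else if n = 36 then -1 else 0 := by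
  have h := coeff_formalEulerPow_one_le_twelve
  interval_cases n <;> simp +decide [coeff_formalEulerScaled, h]

/-- **`E3 = 1 - q ^ 3 - q ^ 6 + q ^ 15 + q ^ 21 - q ^ 36 + o(q³⁷)`.** [folklore] -/
theorem tendsto_eulerFn_three :
    Tendsto (fun τ : ℍ ↦ (eulerFn 3 τ - (1 - X ^ 3 - X ^ 6 + X ^ 15 + X ^ 21 - X ^ 36 : ℂ[X]).eval (Function.Periodic.qParam 1 (τ : ℂ)))
      / Function.Periodic.qParam 1 (τ : ℂ) ^ 37) atImInfty (𝓝 0) := by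
  refine congr_poly ?_ (tendsto_of_hasSum (periodic_eulerFn 3) (mdifferentiable_eulerFn 3)
    (isBoundedAtImInfty_eulerFn (by norm_num)) (hasSum_eulerFn (by norm_num)) 37)
  have h := coeff_formalEulerScaled_three_le
  simp only [Finset.sum_range_succ, Finset.sum_range_zero, h 0 (by norm_num), h 1 (by norm_num), h 2 (by norm_num), h 3 (by norm_num), h 4 (by norm_num), h 5 (by norm_num), h 6 (by norm_num), h 7 (by norm_num), h 8 (by norm_num), h 9 (by norm_num), h 10 (by norm_num), h 11 (by norm_num), h 12 (by norm_num), h 13 (by norm_num), h 14 (by norm_num), h 15 (by norm_num), h 16 (by norm_num), h 17 (by norm_num), h 18 (by norm_num), h 19 (by norm_num), h 20 (by norm_num), h 21 (by norm_num), h 22 (by norm_num), h 23 (by norm_num), h 24 (by norm_num), h 25 (by norm_num), h 26 (by norm_num), h 27 (by norm_num), h 28 (by norm_num), h 29 (by norm_num), h 30 (by norm_num), h 31 (by norm_num), h 32 (by norm_num), h 33 (by norm_num), h 34 (by norm_num), h 35 (by norm_num), h 36 (by norm_num), h 37 (by norm_num)]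
  norm_num
  ring

/-- The `q`-coefficients `n ≤ 37` of `E6` (nonzero only at the multiples `6k` with `k ∈ {0, 1, 2, 5, 7, 12}`). [folklore] -/
theorem coeff_formalEulerScaled_six_le (n : ℕ) (hn : n ≤ 37) :
    PowerSeries.coeff n (formalEulerScaled 6) = if n = 0 then 1 else if n = 6 then -1 else if n = 12 then -1 else if n = 30 then 1 else 0 := by
  have h := coeff_formalEulerPow_one_le_twelve
  interval_cases n <;> simp +decide [coeff_formalEulerScaled, h]

/-- **`E6 = 1 - q ^ 6 - q ^ 12 + q ^ 30 + o(q³⁷)`.** [folklore] -/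
theorem tendsto_eulerFn_six :
    Tendsto (fun τ : ℍ ↦ (eulerFn 6 τ - (1 - X ^ 6 - X ^ 12 + X ^ 30 : ℂ[X]).eval (Function.Periodic.qParam 1 (τ : ℂ)))
      / Function.Periodic.qParam 1 (τ : ℂ) ^ 37) atImInfty (𝓝 0) := by
  refine congr_poly ?_ (tendsto_of_hasSum (periodic_eulerFn 6) (mdifferentiable_eulerFn 6)
    (isBoundedAtImInfty_eulerFn (by norm_num)) (hasSum_eulerFn (by norm_num)) 37)
  have h := coeff_formalEulerScaled_six_le
  simp only [Finset.sum_range_succ, Finset.sum_range_zero, h 0 (by norm_num), h 1 (by norm_num), h 2 (by norm_num), h 3 (by norm_num), h 4 (by norm_num), h 5 (by norm_num), h 6 (by norm_num), h 7 (by norm_num), h 8 (by norm_num), h 9 (by norm_num), h 10 (by norm_num), h 11 (by norm_num), h 12 (by norm_num), h 13 (by norm_num), h 14 (by norm_num), h 15 (by norm_num), h 16 (by norm_num), h 17 (by norm_num), h 18 (by norm_num), h 19 (by norm_num), h 20 (by norm_num), h 21 (by norm_num), h 22 (by norm_num), h 23 (by norm_num), h 24 (by norm_num), h 25 (by norm_num),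 h 26 (by norm_num), h 27 (by norm_num), h 28 (by norm_num), h 29 (by norm_num), h 30 (by norm_num), h 31 (by norm_num), h 32 (by norm_num), h 33 (by norm_num), h 34 (by norm_num), h 35 (by norm_num), h 36 (by norm_num), h 37 (by norm_num)]
  norm_num
  ring

/-- The `q`-coefficients `n ≤ 37` of `E9` (nonzero only at the multiples `9k` with `k ∈ {0, 1, 2, 5, 7, 12}`). [folklore] -/
theorem coeff_formalEulerScaled_nine_le (n : ℕ) (hn : n ≤ 37) :
    PowerSeries.coeff n (formalEulerScaled 9) = if n = 0 then 1 else if n = 9 then -1 else if n = 18 then -1 else 0 := by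
  have h := coeff_formalEulerPow_one_le_twelve
  interval_cases n <;> simp +decide [coeff_formalEulerScaled, h]

/-- **`E9 = 1 - q ^ 9 - q ^ 18 + o(q³⁷)`.** [folklore] -/
theorem tendsto_eulerFn_nine :
    Tendsto (fun τ : ℍ ↦ (eulerFn 9 τ - (1 - X ^ 9 - X ^ 18 : ℂ[X]).eval (Function.Periodic.qParam 1 (τ : ℂ)))
      / Function.Periodic.qParam 1 (τ : ℂ) ^ 37) atImInfty (𝓝 0) := by
  refine congr_poly ?_ (tendsto_of_hasSum (periodic_eulerFn 9) (mdifferentiable_eulerFn 9)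
    (isBoundedAtImInfty_eulerFn (by norm_num)) (hasSum_eulerFn (by norm_num)) 37)
  have h := coeff_formalEulerScaled_nine_le
  simp only [Finset.sum_range_succ, Finset.sum_range_zero, h 0 (by norm_num), h 1 (by norm_num), h 2 (by norm_num), h 3 (by norm_num), h 4 (by norm_num), h 5 (by norm_num), h 6 (by norm_num), h 7 (by norm_num), h 8 (by norm_num), h 9 (by norm_num), h 10 (by norm_num), h 11 (by norm_num), h 12 (by norm_num), h 13 (by norm_num), h 14 (by norm_num), h 15 (by norm_num), h 16 (by norm_num), h 17 (by norm_num), h 18 (by norm_num), h 19 (by norm_num), h 20 (by norm_num), h 21 (by norm_num), h 22 (by norm_num), h 23 (by norm_num), h 24 (by norm_num), h 25 (by norm_num), h 26 (by norm_num), h 27 (by norm_num), h 28 (by norm_num), h 29 (by norm_num), h 30 (by norm_num), h 31 (by norm_num), h 32 (by norm_num), h 33 (by norm_num), h 34 (by norm_num), h 35 (by norm_num), h 36 (by norm_num), h 37 (by norm_num)]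
  norm_num
  ring

/-- The `q`-coefficients `n ≤ 37` of `E12` (nonzero only at the multiples `12k` with `k ∈ {0, 1, 2, 5, 7, 12}`). [folklore] -/
theorem coeff_formalEulerScaled_twelve_le (n : ℕ) (hn : n ≤ 37) :
    PowerSeries.coeff n (formalEulerScaled 12) = if n = 0 then 1 else if n = 12 then -1 else if n = 24 then -1 else 0 := by
  have h := coeff_formalEulerPow_one_le_twelve
  interval_cases n <;> simp +decide [coeff_formalEulerScaled, h]

/-- **`E12 = 1 - q ^ 12 - q ^ 24 + o(q³⁷)`.** [folklore] -/
theorem tendsto_eulerFn_twelve :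
    Tendsto (fun τ : ℍ ↦ (eulerFn 12 τ - (1 - X ^ 12 - X ^ 24 : ℂ[X]).eval (Function.Periodic.qParam 1 (τ : ℂ)))
      / Function.Periodic.qParam 1 (τ : ℂ) ^ 37) atImInfty (𝓝 0) := by
  refine congr_poly ?_ (tendsto_of_hasSum (periodic_eulerFn 12) (mdifferentiable_eulerFn 12)
    (isBoundedAtImInfty_eulerFn (by norm_num)) (hasSum_eulerFn (by norm_num)) 37)
  have h := coeff_formalEulerScaled_twelve_le
  simp only [Finset.sum_range_succ, Finset.sum_range_zero, h 0 (by norm_num), h 1 (by norm_num), h 2 (by norm_num), h 3 (by norm_num), h 4 (by norm_num), h 5 (by norm_num), h 6 (by norm_num), h 7 (by norm_num), h 8 (by norm_num), h 9 (by norm_num), h 10 (by norm_num), h 11 (by norm_num), h 12 (by norm_num), h 13 (by norm_num), h 14 (by norm_num), h 15 (by norm_num), h 16 (by norm_num), h 17 (by norm_num), h 18 (by norm_num), h 19 (by norm_num), h 20 (by norm_num), h 21 (by norm_num), h 22 (by norm_num), h 23 (by norm_num), h 24 (by norm_num), h 25 (by norm_num), h 26 (by norm_num), h 27 (by norm_num),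 h 28 (by norm_num), h 29 (by norm_num), h 30 (by norm_num), h 31 (by norm_num), h 32 (by norm_num), h 33 (by norm_num), h 34 (by norm_num), h 35 (by norm_num), h 36 (by norm_num), h 37 (by norm_num)]
  norm_num
  ring

/-- The `q`-coefficients `n ≤ 37` of `E18` (nonzero only at the multiples `18k` with `k ∈ {0, 1, 2, 5, 7, 12}`). [folklore] -/
theorem coeff_formalEulerScaled_eighteen_le (n : ℕ) (hn : n ≤ 37) :
    PowerSeries.coeff n (formalEulerScaled 18) = if n = 0 then 1 else if n = 18 then -1 else if n = 36 then -1 else 0 := by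
  have h := coeff_formalEulerPow_one_le_twelve
  interval_cases n <;> simp +decide [coeff_formalEulerScaled, h]

/-- **`E18 = 1 - q ^ 18 - q ^ 36 + o(q³⁷)`.** [folklore] -/
theorem tendsto_eulerFn_eighteen :
    Tendsto (fun τ : ℍ ↦ (eulerFn 18 τ - (1 - X ^ 18 - X ^ 36 : ℂ[X]).eval (Function.Periodic.qParam 1 (τ : ℂ)))
      / Function.Periodic.qParam 1 (τ : ℂ) ^ 37) atImInfty (𝓝 0) := by
  refine congr_poly ?_ (tendsto_of_hasSum (periodic_eulerFn 18) (mdifferentiable_eulerFn 18)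
    (isBoundedAtImInfty_eulerFn (by norm_num)) (hasSum_eulerFn (by norm_num)) 37)
  have h := coeff_formalEulerScaled_eighteen_le
  simp only [Finset.sum_range_succ, Finset.sum_range_zero, h 0 (by norm_num), h 1 (by norm_num), h 2 (by norm_num), h 3 (by norm_num), h 4 (by norm_num), h 5 (by norm_num), h 6 (by norm_num), h 7 (by norm_num), h 8 (by norm_num), h 9 (by norm_num), h 10 (by norm_num), h 11 (by norm_num), h 12 (by norm_num), h 13 (by norm_num), h 14 (by norm_num), h 15 (by norm_num), h 16 (by norm_num), h 17 (by norm_num), h 18 (by norm_num), h 19 (by norm_num), h 20 (by norm_num), h 21 (by norm_num), h 22 (by norm_num), h 23 (by norm_num), h 24 (by norm_num), h 25 (by norm_num), h 26 (by norm_num), h 27 (by norm_num), h 28 (by norm_num), h 29 (by norm_num), h 30 (by norm_num), h 31 (by norm_num), h 32 (by norm_num), h 33 (by norm_num), h 34 (by norm_num), h 35 (by norm_num), h 36 (by norm_num), h 37 (by norm_num)]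
  norm_num
  ring

/-- The `q`-coefficients `n ≤ 37` of `E27` (nonzero only at the multiples `27k` with `k ∈ {0, 1, 2, 5, 7, 12}`). [folklore] -/
theorem coeff_formalEulerScaled_twentySeven_le (n : ℕ) (hn : n ≤ 37) :
    PowerSeries.coeff n (formalEulerScaled 27) = if n = 0 then 1 else if n = 27 then -1 else 0 := by
  have h := coeff_formalEulerPow_one_le_twelve
  interval_cases n <;> simp +decide [coeff_formalEulerScaled, h]

/-- **`E27 = 1 - q ^ 27 + o(q³⁷)`.** [folklore] -/
theorem tendsto_eulerFn_twentySeven :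
    Tendsto (fun τ : ℍ ↦ (eulerFn 27 τ - (1 - X ^ 27 : ℂ[X]).eval (Function.Periodic.qParam 1 (τ : ℂ)))
      / Function.Periodic.qParam 1 (τ : ℂ) ^ 37) atImInfty (𝓝 0) := by
  refine congr_poly ?_ (tendsto_of_hasSum (periodic_eulerFn 27) (mdifferentiable_eulerFn 27)
    (isBoundedAtImInfty_eulerFn (by norm_num)) (hasSum_eulerFn (by norm_num)) 37)
  have h := coeff_formalEulerScaled_twentySeven_le
  simp only [Finset.sum_range_succ, Finset.sum_range_zero, h 0 (by norm_num), h 1 (by norm_num), h 2 (by norm_num), h 3 (by norm_num), h 4 (by norm_num), h 5 (by norm_num), h 6 (by norm_num), h 7 (by norm_num), h 8 (by norm_num), h 9 (by norm_num), h 10 (by norm_num), h 11 (by norm_num), h 12 (by norm_num), h 13 (by norm_num), h 14 (by norm_num), h 15 (by norm_num), h 16 (by norm_num), h 17 (by norm_num), h 18 (by norm_num), h 19 (by norm_num), h 20 (by norm_num), h 21 (by norm_num), h 22 (by norm_num), h 23 (by norm_num), h 24 (by norm_num), h 25 (by norm_num), h 26 (by norm_num), h 27 (by norm_num), h 28 (by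 norm_num), h 29 (by norm_num), h 30 (by norm_num), h 31 (by norm_num), h 32 (by norm_num), h 33 (by norm_num), h 34 (by norm_num), h 35 (by norm_num), h 36 (by norm_num), h 37 (by norm_num)]
  norm_num
  ring

/-- The `q`-coefficients `n ≤ 37` of `E36` (nonzero only at the multiples `36k` with `k ∈ {0, 1, 2, 5, 7, 12}`). [folklore] -/
theorem coeff_formalEulerScaled_thirtySix_le (n : ℕ) (hn : n ≤ 37) :
    PowerSeries.coeff n (formalEulerScaled 36) = if n = 0 then 1 else if n = 36 then -1 else 0 := by
  have h := coeff_formalEulerPow_one_le_twelve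
  interval_cases n <;> simp +decide [coeff_formalEulerScaled, h]

/-- **`E36 = 1 - q ^ 36 + o(q³⁷)`.** [folklore] -/
theorem tendsto_eulerFn_thirtySix :
    Tendsto (fun τ : ℍ ↦ (eulerFn 36 τ - (1 - X ^ 36 : ℂ[X]).eval (Function.Periodic.qParam 1 (τ : ℂ)))
      / Function.Periodic.qParam 1 (τ : ℂ) ^ 37) atImInfty (𝓝 0) := by
  refine congr_poly ?_ (tendsto_of_hasSum (periodic_eulerFn 36) (mdifferentiable_eulerFn 36)
    (isBoundedAtImInfty_eulerFn (by norm_num)) (hasSum_eulerFn (by norm_num)) 37)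
  have h := coeff_formalEulerScaled_thirtySix_le
  simp only [Finset.sum_range_succ, Finset.sum_range_zero, h 0 (by norm_num), h 1 (by norm_num), h 2 (by norm_num), h 3 (by norm_num), h 4 (by norm_num), h 5 (by norm_num), h 6 (by norm_num), h 7 (by norm_num), h 8 (by norm_num), h 9 (by norm_num), h 10 (by norm_num), h 11 (by norm_num), h 12 (by norm_num), h 13 (by norm_num), h 14 (by norm_num), h 15 (by norm_num), h 16 (by norm_num), h 17 (by norm_num), h 18 (by norm_num), h 19 (by norm_num), h 20 (by norm_num), h 21 (by norm_num), h 22 (by norm_num), h 23 (by norm_num), h 24 (by norm_num), h 25 (by norm_num), h 26 (by norm_num), h 27 (by norm_num), h 28 (by norm_num), h 29 (by norm_num), h 30 (by norm_num), h 31 (by norm_num), h 32 (by norm_num), h 33 (by norm_num), h 34 (by norm_num), h 35 (by norm_num), h 36 (by norm_num), h 37 (by norm_num)]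
  norm_num
  ring

/-! ## §2 `σ₁(1..12)` and `E₂(δτ)` to `o(q³⁷)` -/

/-- `σ₁(n)` for `n = 1, …, 12`: `1, 3, 4, 7, 6, 12, 8, 15, 13, 18, 12, 28`. [folklore] -/
theorem sigma_one_le_twelve : ArithmeticFunction.sigma 1 1 = 1 ∧ ArithmeticFunction.sigma 1 2 = 3 ∧ ArithmeticFunction.sigma 1 3 = 4 ∧ ArithmeticFunction.sigma 1 4 = 7 ∧ ArithmeticFunction.sigma 1 5 = 6 ∧ ArithmeticFunction.sigma 1 6 = 12 ∧ ArithmeticFunction.sigma 1 7 = 8 ∧ ArithmeticFunction.sigma 1 8 = 15 ∧ ArithmeticFunction.sigma 1 9 = 13 ∧ ArithmeticFunction.sigma 1 10 = 18 ∧ ArithmeticFunction.sigma 1 11 = 12 ∧ ArithmeticFunction.sigma 1 12 = 28 := by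
  refine ⟨by decide, by decide, by decide, by decide, by decide, by decide, by decide, by decide, by decide, by decide, by decide,
    by decide⟩

/-- **`E₂(3τ) = 1 - 24 * q ^ 3 - 72 * q ^ 6 - 96 * q ^ 9 - 168 * q ^ 12 - 144 * q ^ 15 - 288 * q ^ 18 - 192 * q ^ 21 - 360 * q ^ 24 - 312 * q ^ 27 - 432 * q ^ 30 - 288 * q ^ 33 - 672 * q ^ 36 + o(q³⁷)`.** [cite: Zagier2008, §2.3] -/
theorem tendsto_E2_three :
    Tendsto (fun τ : ℍ ↦ (E2 (sixMulPt 3 τ) - (1 - 24 * X ^ 3 - 72 * X ^ 6 - 96 * X ^ 9 - 168 * X ^ 12 - 144 * X ^ 15 - 288 * X ^ 18 - 192 * X ^ 21 - 360 * X ^ 24 - 312 * X ^ 27 - 432 * X ^ 30 - 288 * X ^ 33 - 672 * X ^ 36 : ℂ[X]).eval (Function.Periodic.qParam 1 (τ : ℂ)))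
      / Function.Periodic.qParam 1 (τ : ℂ) ^ 37) atImInfty (𝓝 0) := by
  refine congr_poly ?_ (tendsto_E2_sixMulPt (by norm_num : 0 < 3) 37)
  obtain ⟨s1, s2, s3, s4, s5, s6, s7, s8, s9, s10, s11, s12⟩ := sigma_one_le_twelve
  simp only [Finset.sum_range_succ, Finset.sum_range_zero, e2NatMulCoeff_eq _ _ (by norm_num : 0 < 3)]
  norm_num [s1, s2, s3, s4, s5, s6, s7, s8, s9, s10, s11, s12]
  simp only [map_ofNat]
  ring

/-- **`E₂(6τ) = 1 - 24 * q ^ 6 - 72 * q ^ 12 - 96 * q ^ 18 - 168 * q ^ 24 - 144 * q ^ 30 - 288 * q ^ 36 + o(q³⁷)`.** [cite: Zagier2008, §2.3] -/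
theorem tendsto_E2_six :
    Tendsto (fun τ : ℍ ↦ (E2 (sixMulPt 6 τ) - (1 - 24 * X ^ 6 - 72 * X ^ 12 - 96 * X ^ 18 - 168 * X ^ 24 - 144 * X ^ 30 - 288 * X ^ 36 : ℂ[X]).eval (Function.Periodic.qParam 1 (τ : ℂ)))
      / Function.Periodic.qParam 1 (τ : ℂ) ^ 37) atImInfty (𝓝 0) := by
  refine congr_poly ?_ (tendsto_E2_sixMulPt (by norm_num : 0 < 6) 37)
  obtain ⟨s1, s2, s3, s4, s5, s6, s7, s8, s9, s10, s11, s12⟩ := sigma_one_le_twelve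
  simp only [Finset.sum_range_succ, Finset.sum_range_zero, e2NatMulCoeff_eq _ _ (by norm_num : 0 < 6)]
  norm_num [s1, s2, s3, s4, s5, s6, s7, s8, s9, s10, s11, s12]
  simp only [map_ofNat]
  ring

/-- **`E₂(9τ) = 1 - 24 * q ^ 9 - 72 * q ^ 18 - 96 * q ^ 27 - 168 * q ^ 36 + o(q³⁷)`.** [cite: Zagier2008, §2.3] -/
theorem tendsto_E2_nine :
    Tendsto (fun τ : ℍ ↦ (E2 (sixMulPt 9 τ) - (1 - 24 * X ^ 9 - 72 * X ^ 18 - 96 * X ^ 27 - 168 * X ^ 36 : ℂ[X]).eval (Function.Periodic.qParam 1 (τ : ℂ)))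
      / Function.Periodic.qParam 1 (τ : ℂ) ^ 37) atImInfty (𝓝 0) := by
  refine congr_poly ?_ (tendsto_E2_sixMulPt (by norm_num : 0 < 9) 37)
  obtain ⟨s1, s2, s3, s4, s5, s6, s7, s8, s9, s10, s11, s12⟩ := sigma_one_le_twelve
  simp only [Finset.sum_range_succ, Finset.sum_range_zero, e2NatMulCoeff_eq _ _ (by norm_num : 0 < 9)]
  norm_num [s1, s2, s3, s4, s5, s6, s7, s8, s9, s10, s11, s12]
  simp only [map_ofNat]
  ring

/-- **`E₂(12τ) = 1 - 24 * q ^ 12 - 72 * q ^ 24 - 96 * q ^ 36 + o(q³⁷)`.** [cite: Zagier2008, §2.3] -/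
theorem tendsto_E2_twelve :
    Tendsto (fun τ : ℍ ↦ (E2 (sixMulPt 12 τ) - (1 - 24 * X ^ 12 - 72 * X ^ 24 - 96 * X ^ 36 : ℂ[X]).eval (Function.Periodic.qParam 1 (τ : ℂ)))
      / Function.Periodic.qParam 1 (τ : ℂ) ^ 37) atImInfty (𝓝 0) := by
  refine congr_poly ?_ (tendsto_E2_sixMulPt (by norm_num : 0 < 12) 37)
  obtain ⟨s1, s2, s3, s4, s5, s6, s7, s8, s9, s10, s11, s12⟩ := sigma_one_le_twelve
  simp only [Finset.sum_range_succ, Finset.sum_range_zero, e2NatMulCoeff_eq _ _ (by norm_num : 0 < 12)]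
  norm_num [s1, s2, s3, s4, s5, s6, s7, s8, s9, s10, s11, s12]
  simp only [map_ofNat]
  ring

/-- **`E₂(18τ) = 1 - 24 * q ^ 18 - 72 * q ^ 36 + o(q³⁷)`.** [cite: Zagier2008, §2.3] -/
theorem tendsto_E2_eighteen :
    Tendsto (fun τ : ℍ ↦ (E2 (sixMulPt 18 τ) - (1 - 24 * X ^ 18 - 72 * X ^ 36 : ℂ[X]).eval (Function.Periodic.qParam 1 (τ : ℂ)))
      / Function.Periodic.qParam 1 (τ : ℂ) ^ 37) atImInfty (𝓝 0) := by
  refine congr_poly ?_ (tendsto_E2_sixMulPt (by norm_num : 0 < 18) 37)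
  obtain ⟨s1, s2, s3, s4, s5, s6, s7, s8, s9, s10, s11, s12⟩ := sigma_one_le_twelve
  simp only [Finset.sum_range_succ, Finset.sum_range_zero, e2NatMulCoeff_eq _ _ (by norm_num : 0 < 18)]
  norm_num [s1, s2, s3, s4, s5, s6, s7, s8, s9, s10, s11, s12]
  simp only [map_ofNat]
  ring

/-- **`E₂(36τ) = 1 - 24 * q ^ 36 + o(q³⁷)`.** [cite: Zagier2008, §2.3] -/
theorem tendsto_E2_thirtySix :
    Tendsto (fun τ : ℍ ↦ (E2 (sixMulPt 36 τ) - (1 - 24 * X ^ 36 : ℂ[X]).eval (Function.Periodic.qParam 1 (τ : ℂ)))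
      / Function.Periodic.qParam 1 (τ : ℂ) ^ 37) atImInfty (𝓝 0) := by
  refine congr_poly ?_ (tendsto_E2_sixMulPt (by norm_num : 0 < 36) 37)
  obtain ⟨s1, s2, s3, s4, s5, s6, s7, s8, s9, s10, s11, s12⟩ := sigma_one_le_twelve
  simp only [Finset.sum_range_succ, Finset.sum_range_zero, e2NatMulCoeff_eq _ _ (by norm_num : 0 < 36)]
  norm_num [s1, s2, s3, s4, s5, s6, s7, s8, s9, s10, s11, s12]
  simp only [map_ofNat]
  ring

end Summit.BirchSwinnertonDyer.BirchSwinnertonDyer.Theorems.ManinLocalTwoThree.EulerRemaindersOneHundredEight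

end
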